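import Summits.CriticalPhenomena.PercolationContinuityZ3.Theorems.PercNearOneGluingNoHeavyQuantGluedTwoColDual
import Summits.CriticalPhenomena.PercolationContinuityZ3.Theorems.PercNearOneGluingNoHeavyQuantGluedWindowLight
import HarnessLib

/-!
# QUANT lane R8, T-DEC: LEMMA W's pair condition in the two-row regime — SECOND h-LOW CELL: the bottom copy of the low atom cannot pair with its top
# copy, the middle copy and the high atom are light into it; two columns, NO cheapness (arm-1 gen 59, architect)

builds on p205010 (kernel theorem, internal audit signed; external expert review pending)

Support file (`--supports stmt-CriticalPhenomena-4575`), QUANT lane seat prim-quant-arm-1 (gen 59); memo `run/shared/lean/prim/quant/prim-quant-arm-1-g59/ARCH-G59.md`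
§7.  Theorems only; standard axioms, no sorries, no definitions.  The two-row regime of LEMMA W (`2(l+r) < T ≤ 2(l+r+k)`, `l+r+k ≤ j`) splits by the status of
`h`; when `h` is LOW for the glued target `T` the survey (kit j297905) says the column `L2 = l+r+k` and the giants at the floor rate suffice — no cheap atom.  This
file (companion of `…QuantGluedWindowFarLight`) proves the cell in which `l` is INCOMPATIBLE with `L2` (`2l + r + k ≤ T`), `l+r` is LIGHT into `L2`
(`T − 2(l+r) ≤ yk`) and `h` is LIGHT into `L2` (`T − 2h ≤ y(L2 − h)`), for either status of `h+r` (**`gluedPullback_windowPair_twoRow_nearLight`**): the row `l`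
rides the giant `h+r+k`; the rows `l+r`, `h` (and `h+r` when low) are shared between `L2` and the giant by the order-free two-column criterion
`GluedWindow.twoCol_dual_three` (`…QuantGluedTwoColDual`), whose kink checks hold piecewise (`(t₀+t₁)κ ≤ t₂` for a light rate `κ`, `(t₀+t₁)u ≤ t₂`), and whose
pool capacity `E = γt₂ − (1−γ)t₀u` is positive because an incompatible bottom copy forces `ρ₀ > 2t₀`, hence `γ ≥ y² + 2(1−y)t₀` and
`γ(1−y+t₀) − t₀ ≥ (1−y)((y−t₀)(y−2t₀) + t₀) > 0`.

HONEST STATUS.  `GluedLemmaW` (flow form), `GluedDominatedMass`, the band, `SiblingStep`, `FarTreeRow` OPEN; RATE class (log\*) / honest sentence of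
`run/shared/lean/prim/quant/README.md` unchanged.  [this work].  Nothing here is cited as a published result.  The gluing rows served
[cite: KozmaNitzan2024, Conjecture 3 (p. 15)]; product measure [cite: Grimmett1999, §1.3 p. 10].
-/

set_option maxHeartbeats 4000000

noncomputable section

open scoped BigOperators

namespace Summit.CriticalPhenomena.PercolationContinuityZ3.Theorems
namespace Quant

open Finset

namespace LawDec

/-- **TWO-ROW REGIME, CELL "near & light"**: `l+r+k ≤ j` a mid for the glued target (`T ≤ 2(l+r+k)`), the bottom copy `l` incompatible with it
(`2l + r + k ≤ T`), the middle copy low and light into it (`2(l+r) < T`, `T − 2(l+r) ≤ y·k`), `h` low (`2h < T`) and light into it (`T − 2h ≤ y·(l+r+k−h)`).  Then for EVERY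
price system `(α, p)` at `(y, T, j)`: `(1−γ)Ψ(l) + γΨ(h) ≤ 0` — without any cheap atom. [this work] -/
theorem gluedPullback_windowPair_twoRow_nearLight (x a q g S : ℝ) (B r k j l h : ℕ) (α p : ℕ → ℝ)
    (hx0 : 0 < x) (hx1 : x < 1) (ha0 : 0 < a) (ha1 : a ≤ 1) (hq0 : 0 < q) (hq1 : q < 1) (hg1 : g ≤ 1) (hk : 1 ≤ k)
    (hxqg : x ≤ q * g)
    (hlh : l < h) (hhB : h ≤ B) (hhj : h ≤ j) (hwin : j < h + r + k) (hlow : 2 * (l : ℝ) < a * S) (hcomp : a * S < (l : ℝ) + h)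
    (hlight : pairGate (a * x) (a * S) l h < a * x)
    (hL2j : l + r + k ≤ j) (hL2mid : a * (S + q * ((r : ℝ) + k * g)) ≤ 2 * ((l : ℝ) + r + k))
    (hincl : 2 * (l : ℝ) + r + k ≤ a * (S + q * ((r : ℝ) + k * g))) (hL1low : 2 * ((l : ℝ) + r) < a * (S + q * ((r : ℝ) + k * g)))
    (hL1light : a * (S + q * ((r : ℝ) + k * g)) - 2 * ((l : ℝ) + r) ≤ (a * x) * k) (hhlow : 2 * (h : ℝ) < a * (S + q * ((r : ℝ) + k * g)))
    (hhlight : a * (S + q * ((r : ℝ) + k * g)) - 2 * (h : ℝ) ≤ (a * x) * ((l : ℝ) + r + k - h))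
    (hp : ∀ h, 0 ≤ p h)
    (hαp : ∀ l' h', l' ≤ j → 2 * (l' : ℝ) < a * (S + q * ((r : ℝ) + k * g)) → h' ≤ B + (r + k) →
      (j + 1 ≤ h' ∨ a * (S + q * ((r : ℝ) + k * g)) < (l' : ℝ) + h') →
      α l' ≤ usage (a * x) (a * (S + q * ((r : ℝ) + k * g))) j l' h' * p h') :
    (1 - pairGate (a * x) (a * S) l h) * gluedPullback (a * (S + q * ((r : ℝ) + k * g))) q g j r k α p l
      + pairGate (a * x) (a * S) l h * gluedPullback (a * (S + q * ((r : ℝ) + k * g))) q g j r k α p h ≤ 0 := by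
  set y : ℝ := a * x with hy
  set T : ℝ := a * (S + q * ((r : ℝ) + k * g)) with hT
  set T₀ : ℝ := a * S with hT₀
  set t0 : ℝ := 1 - q with ht0
  set t1 : ℝ := q * (1 - g) with ht1
  set t2 : ℝ := q * g with ht2
  clear_value y T T₀ t0 t1 t2
  have hy0 : 0 < y := by rw [hy]; exact mul_pos ha0 hx0
  have hyx : y ≤ x := by rw [hy]; nlinarith
  have hy1 : y < 1 := by linarith
  have h1y : 0 < 1 - y := by linarith
  have hu0 : 0 ≤ y / (1 - y) := div_nonneg hy0.le h1y.le
  have hyt2 : y ≤ t2 := by rw [ht2]; linarith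
  have ht0p : 0 ≤ t0 := by rw [ht0]; linarith
  have ht1p : 0 ≤ t1 := by rw [ht1]; exact mul_nonneg hq0.le (by linarith)
  have ht2p : 0 ≤ t2 := by linarith
  have hts : t0 + t1 + t2 = 1 := by rw [ht0, ht1, ht2]; ring
  have ht21 : t2 ≤ 1 := by linarith
  have ht2q : t2 ≤ q := by rw [ht2]; nlinarith
  have hr0 : (0:ℝ) ≤ r := Nat.cast_nonneg r
  have hk1 : (1:ℝ) ≤ k := by exact_mod_cast hk
  have hkpos : (0:ℝ) < k := by linarith
  -- T − T₀ = a·(q r + t2 k) =: A ≤ q (r + k)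
  have hA : T - T₀ = a * (q * (r : ℝ) + t2 * k) := by rw [hT, hT₀, ht2]; ring
  have hAq : a * (q * (r : ℝ) + t2 * k) ≤ q * ((r : ℝ) + k) := by
    have h1 : q * (r : ℝ) + t2 * k ≤ q * ((r : ℝ) + k) := by nlinarith [mul_le_mul_of_nonneg_right ht2q hkpos.le]
    have h2 : a * (q * (r : ℝ) + t2 * k) ≤ 1 * (q * (r : ℝ) + t2 * k) := mul_le_mul_of_nonneg_right ha1 (by positivity)
    linarith
  have hAK : a * (q * (r : ℝ) + t2 * k) ≤ (r : ℝ) + k := by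
    have : q * ((r : ℝ) + k) ≤ 1 * ((r : ℝ) + k) := mul_le_mul_of_nonneg_right hq1.le (by positivity)
    linarith
  have hlh' : (l : ℝ) < h := by exact_mod_cast hlh
  have hd0 : (0:ℝ) < (h : ℝ) - l := by linarith
  have hTlt : T < (h : ℝ) + ((l : ℝ) + r + k) := by
    have : T ≤ T₀ + ((r : ℝ) + k) := by linarith [hA, hAK]
    linarith
  -- the light gate γ = y² + (1−y)ρ₀ and the cell's lower bound ρ₀ > 2t₀
  obtain ⟨ρ₀, hρ₀⟩ : ∃ ρ₀ : ℝ, ρ₀ = (T₀ - 2 * (l : ℝ)) / ((h : ℝ) - l) := ⟨_, rfl⟩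
  have hρ₀y : ρ₀ < y := by
    have : (T₀ - 2 * (l : ℝ)) / ((h : ℝ) - l) ≤ pairGate y T₀ l h := le_max_left _ _
    rw [hρ₀]; linarith
  have hρ₀0 : 0 < ρ₀ := by rw [hρ₀]; exact div_pos (by linarith) hd0
  have hγ : pairGate y T₀ l h = y ^ 2 + (1 - y) * ρ₀ := by
    rw [hρ₀]; exact pairGate_eq_light y T₀ l h hy0.le (by rw [← hρ₀]; exact hρ₀y.le)
  have eT₀ : T₀ - 2 * (l : ℝ) = ρ₀ * ((h : ℝ) - l) := by rw [hρ₀]; field_simp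
  obtain ⟨d, hd⟩ : ∃ d : ℝ, d = (h : ℝ) - l := ⟨_, rfl⟩
  rw [← hd] at eT₀
  -- (B): d(2 − ρ₀) < A;  (A): r + k ≤ ρ₀ d + A
  have hB : d * (2 - ρ₀) < a * (q * (r : ℝ) + t2 * k) := by
    have h1 : 2 * (h : ℝ) < 2 * (l : ℝ) + ρ₀ * d + a * (q * (r : ℝ) + t2 * k) := by linarith [hA, eT₀]
    have e : d * (2 - ρ₀) = 2 * (h : ℝ) - 2 * (l : ℝ) - ρ₀ * d := by rw [hd]; ring
    linarith [e, h1]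
  have hAr : (r : ℝ) + k ≤ ρ₀ * d + a * (q * (r : ℝ) + t2 * k) := by linarith [hA, eT₀]
  have h2ρ : 0 < 2 - ρ₀ := by linarith
  have hE1 : ((r : ℝ) + k) * (2 - ρ₀) < 2 * (a * (q * (r : ℝ) + t2 * k)) := by
    have s1 : ((r : ℝ) + k - a * (q * (r : ℝ) + t2 * k)) * (2 - ρ₀) ≤ ρ₀ * d * (2 - ρ₀) :=
      mul_le_mul_of_nonneg_right (by linarith) h2ρ.le
    have s2 : ρ₀ * d * (2 - ρ₀) < ρ₀ * (a * (q * (r : ℝ) + t2 * k)) := by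
      have := mul_lt_mul_of_pos_left hB hρ₀0
      linarith [this]
    nlinarith [s1, s2]
  have hρ₀t0 : 2 * t0 < ρ₀ := by
    have h1 : ((r : ℝ) + k) * (2 - ρ₀) < ((r : ℝ) + k) * (2 * q) := by
      have e : ((r : ℝ) + k) * (2 * q) = 2 * (q * ((r : ℝ) + k)) := by ring
      linarith only [hE1, hAq, e]
    have := lt_of_mul_lt_mul_left h1 (by positivity)
    rw [ht0]; linarith
  have hyt0 : 2 * t0 < y := by linarith
  obtain ⟨γ, hγdef⟩ : ∃ γ : ℝ, γ = y ^ 2 + (1 - y) * ρ₀ := ⟨_, rfl⟩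
  have hγ' : pairGate y T₀ l h = γ := by rw [hγ, hγdef]
  have hγ0 : 0 ≤ γ := by rw [hγdef]; nlinarith [mul_nonneg h1y.le hρ₀0.le, sq_nonneg y]
  have hγ1 : γ ≤ 1 := by rw [hγdef]; nlinarith [mul_le_mul_of_nonneg_left hρ₀y.le h1y.le]
  have h1γ : 0 ≤ 1 - γ := by linarith
  have hγlow : y ^ 2 + 2 * (1 - y) * t0 ≤ γ := by
    rw [hγdef]; nlinarith [mul_le_mul_of_nonneg_left hρ₀t0.le h1y.le]
  -- the pool capacity left after the row l: E = γ t2 − (1−γ) t0 u ≥ 0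
  obtain ⟨E, hE⟩ : ∃ E : ℝ, E = γ * t2 - (1 - γ) * t0 * (y / (1 - y)) := ⟨_, rfl⟩
  have et01 : t0 + t1 = 1 - t2 := by linarith
  have hE0 : 0 ≤ E := by
    have e1 : E * (1 - y) = γ * t2 * (1 - y) - (1 - γ) * t0 * y := by rw [hE]; field_simp
    have a1 : γ * y * (1 - y) ≤ γ * t2 * (1 - y) := mul_le_mul_of_nonneg_right (mul_le_mul_of_nonneg_left hyt2 hγ0) h1y.le
    -- γ(1−y+t0) − t0 ≥ (y² + 2(1−y)t0)(1−y+t0) − t0 = (1−y)((y−t0)(y−2t0) + t0) ≥ 0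
    have a2 : (y ^ 2 + 2 * (1 - y) * t0) * (1 - y + t0) ≤ γ * (1 - y + t0) :=
      mul_le_mul_of_nonneg_right hγlow (by linarith)
    have e2 : (y ^ 2 + 2 * (1 - y) * t0) * (1 - y + t0) - t0 = (1 - y) * ((y - t0) * (y - 2 * t0) + t0) := by ring
    have a3 : 0 ≤ (1 - y) * ((y - t0) * (y - 2 * t0) + t0) :=
      mul_nonneg h1y.le (add_nonneg (mul_nonneg (by linarith) (by linarith)) ht0p)
    have a4 : 0 ≤ y * (γ * (1 - y + t0) - t0) := mul_nonneg hy0.le (by linarith [a2, e2, a3])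
    have e3 : γ * y * (1 - y) - (1 - γ) * t0 * y = y * (γ * (1 - y + t0) - t0) := by ring
    have h3 : 0 ≤ E * (1 - y) := by rw [e1]; linarith [a1, a4, e3]
    by_contra hneg
    have : E * (1 - y) < 0 := mul_neg_of_neg_of_pos (not_le.mp hneg) h1y
    linarith
  -- (t0 + t1) u ≤ t2
  have hut : (t0 + t1) * (y / (1 - y)) ≤ t2 := by
    rw [← mul_div_assoc, div_le_iff₀ h1y, et01]
    nlinarith [mul_le_mul_of_nonneg_left hyt2 (show (0:ℝ) ≤ 1 - t2 by linarith)]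
  -- the kink check for a light A-row with rate κ': (all rows' weight)·u·κ' ≤ (1−γ)t2 u + E κ'
  have kink : ∀ κ' : ℝ, 0 ≤ κ' → (t0 + t1) * κ' ≤ t2 →
      ((1 - γ) * t1 + γ * (t0 + t1)) * (y / (1 - y)) * κ' ≤ (1 - γ) * t2 * (y / (1 - y)) + E * κ' := by
    intro κ' hκ0 hκt
    have p1 : 0 ≤ (1 - γ) * (y / (1 - y)) * (t2 - (t0 + t1) * κ') := mul_nonneg (mul_nonneg h1γ hu0) (by linarith only [hκt])
    have p2 : 0 ≤ γ * κ' * (t2 - (t0 + t1) * (y / (1 - y))) := mul_nonneg (mul_nonneg hγ0 hκ0) (by linarith only [hut])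
    have e : (1 - γ) * t2 * (y / (1 - y)) + E * κ' - ((1 - γ) * t1 + γ * (t0 + t1)) * (y / (1 - y)) * κ'
        = (1 - γ) * (y / (1 - y)) * (t2 - (t0 + t1) * κ') + γ * κ' * (t2 - (t0 + t1) * (y / (1 - y))) := by rw [hE]; ring
    linarith only [p1, p2, e]
  -- low / non-low statuses
  have hL0 : l ≤ j ∧ 2 * (l : ℝ) < T := ⟨by omega, by linarith⟩
  have hL1 : l + r ≤ j ∧ 2 * ((l + r : ℕ) : ℝ) < T := ⟨by omega, by push_cast; linarith only [hL1low]⟩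
  have hL2n : ¬ (l + r + k ≤ j ∧ 2 * ((l + r + k : ℕ) : ℝ) < T) := by push_cast; intro hh; linarith [hh.2]
  have hH0 : h ≤ j ∧ 2 * (h : ℝ) < T := ⟨hhj, hhlow⟩
  have hH2n : ¬ (h + r + k ≤ j ∧ 2 * ((h + r + k : ℕ) : ℝ) < T) := fun hh => absurd hh.1 (by omega)
  have cL : ∀ v : ℕ, (v ≤ j ∧ 2 * (v : ℝ) < T) → coefAt T j α p v = α v := fun v hv => by simp only [coefAt, if_pos hv]
  have cN : ∀ v : ℕ, ¬ (v ≤ j ∧ 2 * (v : ℝ) < T) → coefAt T j α p v = -p v := fun v hv => by simp only [coefAt, if_neg hv]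
  have eΨl : gluedPullback T q g j r k α p l = t0 * α l + t1 * α (l + r) - t2 * p (l + r + k) := by
    simp only [gluedPullback, cL l hL0, cL (l + r) hL1, cN (l + r + k) hL2n, ht0, ht1, ht2]; ring
  have eΨh : gluedPullback T q g j r k α p h = t0 * α h + t1 * coefAt T j α p (h + r) - t2 * p (h + r + k) := by
    simp only [gluedPullback, cL h hH0, cN (h + r + k) hH2n, ht0, ht1, ht2]; ring
  -- prices: pA = p(L2), P = p(H2); u = y/(1−y)
  set pA : ℝ := p (l + r + k) with hpA
  set P : ℝ := p (h + r + k) with hP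
  have hpA0 : 0 ≤ pA := hp _
  have hP0 : 0 ≤ P := hp _
  have hH2M : h + r + k ≤ B + (r + k) := by omega
  have hL2M : l + r + k ≤ B + (r + k) := by omega
  have giant : ∀ w : ℕ, w ≤ j → 2 * (w : ℝ) < T → α w ≤ y / (1 - y) * P := by
    intro w hwj hwl
    have := hαp w (h + r + k) hwj hwl hH2M (Or.inl (by omega))
    rwa [usage_giant_eq y T j w (h + r + k) (by omega)] at this
  have bl := giant l hL0.1 hL0.2
  -- a LIGHT low row w into L2: κ_w = G/(1−G), G = y² + (1−y)ρ_w ≤ y ≤ t2, so (t0+t1)κ_w ≤ t2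
  have hL2r : ((l + r + k : ℕ) : ℝ) = (l : ℝ) + r + k := by push_cast; ring
  have rowA : ∀ w : ℕ, w ≤ j → 2 * (w : ℝ) < T → (w : ℝ) < (l : ℝ) + r + k →
      (T - 2 * (w : ℝ)) / (((l + r + k : ℕ) : ℝ) - w) ≤ y →
      ∃ κ : ℝ, 0 ≤ κ ∧ (t0 + t1) * κ ≤ t2 ∧ α w ≤ κ * pA ∧ α w ≤ y / (1 - y) * P := by
    intro w hwj hwl hwL2 hρw'
    have hdw : (0:ℝ) < ((l + r + k : ℕ) : ℝ) - w := by rw [hL2r]; linarith only [hwL2]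
    obtain ⟨ρ, hρ⟩ : ∃ ρ : ℝ, ρ = (T - 2 * (w : ℝ)) / (((l + r + k : ℕ) : ℝ) - w) := ⟨_, rfl⟩
    have hρw : ρ ≤ y := by rw [hρ]; exact hρw'
    have hρw0 : 0 ≤ ρ := by rw [hρ]; exact div_nonneg (by linarith only [hwl]) hdw.le
    have hρ1 : ρ < 1 := by linarith only [hρw, hy1]
    have hcompw : T < (w : ℝ) + ((l + r + k : ℕ) : ℝ) := by
      have : T - 2 * (w : ℝ) < ((l + r + k : ℕ) : ℝ) - w := by
        have h1 := (div_lt_one hdw).mp (by rw [← hρ]; exact hρ1)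
        exact h1
      linarith only [this]
    have eκ : usage y T j w (l + r + k) = (y ^ 2 + (1 - y) * ρ) / (1 - (y ^ 2 + (1 - y) * ρ)) := by
      rw [hρ]; exact usage_light_eq y T j w (l + r + k) hy0.le hL2j (by rw [← hρ]; exact hρw)
    have hG : y ^ 2 + (1 - y) * ρ ≤ y := by
      have := mul_le_mul_of_nonneg_left hρw h1y.le
      nlinarith only [this]
    have hG0 : 0 ≤ y ^ 2 + (1 - y) * ρ := add_nonneg (sq_nonneg y) (mul_nonneg h1y.le hρw0)
    have hG1 : 0 < 1 - (y ^ 2 + (1 - y) * ρ) := by linarith only [hG, hy1]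
    refine ⟨usage y T j w (l + r + k), ?_, ?_, ?_, giant w hwj hwl⟩
    · rw [eκ]; exact div_nonneg hG0 hG1.le
    · rw [eκ, ← mul_div_assoc, div_le_iff₀ hG1, et01]
      nlinarith only [hG, hyt2, hG0, ht21]
    · exact hαp w (l + r + k) hwj hwl hL2M (Or.inr hcompw)
  -- the three candidate A-rows: l+r (light by hypothesis), h (light by hypothesis), h+r (lighter than h)
  have hdh : (0:ℝ) < (l : ℝ) + r + k - h := by linarith only [hhlow, hL2mid]
  have hρh : (T - 2 * (h : ℝ)) / (((l + r + k : ℕ) : ℝ) - h) ≤ y := by rw [hL2r, div_le_iff₀ hdh]; exact hhlight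
  have hρ1 : (T - 2 * ((l + r : ℕ) : ℝ)) / (((l + r + k : ℕ) : ℝ) - ((l + r : ℕ) : ℝ)) ≤ y := by
    have e : ((l + r + k : ℕ) : ℝ) - ((l + r : ℕ) : ℝ) = k := by push_cast; ring
    rw [e, div_le_iff₀ hkpos]; push_cast; linarith only [hL1light]
  have hL1lt : ((l + r : ℕ) : ℝ) < (l : ℝ) + r + k := by push_cast; linarith only [hkpos]
  have hhlt : (h : ℝ) < (l : ℝ) + r + k := by linarith only [hdh]
  obtain ⟨κ1, hκ10, hκ1t, b1A, b1P⟩ := rowA (l + r) hL1.1 hL1.2 hL1lt hρ1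
  obtain ⟨κh, hκh0, hκht, bhA, bhP⟩ := rowA h hhj hhlow hhlt hρh
  -- assemble: (1−γ) t0 αl ≤ (1−γ) t0 u P
  have low1 : (1 - γ) * (t0 * α l) ≤ (1 - γ) * t0 * (y / (1 - y)) * P := by
    have h2 := mul_le_mul_of_nonneg_left (mul_le_mul_of_nonneg_left bl ht0p) h1γ
    have e : (1 - γ) * (t0 * (y / (1 - y) * P)) = (1 - γ) * t0 * (y / (1 - y)) * P := by ring
    linarith only [h2, e]
  have hw1 : 0 ≤ (1 - γ) * t1 := mul_nonneg h1γ ht1p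
  have hwh : 0 ≤ γ * t0 := mul_nonneg hγ0 ht0p
  have hwH : 0 ≤ γ * t1 := mul_nonneg hγ0 ht1p
  rw [hγ', eΨl, eΨh]
  by_cases hH1 : h + r ≤ j ∧ 2 * ((h + r : ℕ) : ℝ) < T
  · -- h + r low: third A-row, lighter than h
    rw [cL (h + r) hH1]
    have hHlt : ((h + r : ℕ) : ℝ) < (l : ℝ) + r + k := by linarith only [hH1.2, hL2mid]
    have hρH : (T - 2 * ((h + r : ℕ) : ℝ)) / (((l + r + k : ℕ) : ℝ) - ((h + r : ℕ) : ℝ)) ≤ y := by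
      refine le_trans ?_ hρh
      rw [hL2r]
      exact ratio_anti_low T (h : ℝ) ((h + r : ℕ) : ℝ) ((l : ℝ) + r + k) (by push_cast; linarith only [hr0]) hHlt hL2mid
    obtain ⟨κH, hκH0, hκHt, bHA, bHP⟩ := rowA (h + r) hH1.1 hH1.2 hHlt hρH
    have two := GluedWindow.twoCol_dual_three ((1 - γ) * t1) (γ * t0) (γ * t1) κ1 κh κH (y / (1 - y)) (y / (1 - y)) (y / (1 - y))
      (α (l + r)) (α h) (α (h + r)) ((1 - γ) * t2) E pA P hw1 hwh hwH hκ10 hκh0 hκH0 hu0 hu0 hu0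
      (mul_nonneg h1γ ht2p) hE0 hpA0 hP0 b1A bhA bHA b1P bhP bHP ?_ ?_ ?_
    · have eL : (1 - γ) * (t0 * α l + t1 * α (l + r) - t2 * pA) + γ * (t0 * α h + t1 * α (h + r) - t2 * P)
          = (1 - γ) * (t0 * α l) + ((1 - γ) * t1 * α (l + r) + γ * t0 * α h + γ * t1 * α (h + r)) - (1 - γ) * t2 * pA - γ * t2 * P := by
        ring
      have eR : (1 - γ) * t0 * (y / (1 - y)) * P + ((1 - γ) * t2 * pA + E * P) - (1 - γ) * t2 * pA - γ * t2 * P = 0 := by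
        rw [hE]; ring
      linarith only [two, low1, eL, eR]
    · have k1 := kink κ1 hκ10 hκ1t
      have f1 := mul_le_mul_of_nonneg_left (min_le_right (κ1 * (y / (1 - y))) (y / (1 - y) * κ1)) hw1
      have f2 := mul_le_mul_of_nonneg_left (min_le_right (κh * (y / (1 - y))) (y / (1 - y) * κ1)) hwh
      have f3 := mul_le_mul_of_nonneg_left (min_le_right (κH * (y / (1 - y))) (y / (1 - y) * κ1)) hwH
      have e : (1 - γ) * t1 * (y / (1 - y) * κ1) + γ * t0 * (y / (1 - y) * κ1) + γ * t1 * (y / (1 - y) * κ1)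
          = ((1 - γ) * t1 + γ * (t0 + t1)) * (y / (1 - y)) * κ1 := by ring
      linarith only [f1, f2, f3, k1, e]
    · have k1 := kink κh hκh0 hκht
      have f1 := mul_le_mul_of_nonneg_left (min_le_right (κ1 * (y / (1 - y))) (y / (1 - y) * κh)) hw1
      have f2 := mul_le_mul_of_nonneg_left (min_le_right (κh * (y / (1 - y))) (y / (1 - y) * κh)) hwh
      have f3 := mul_le_mul_of_nonneg_left (min_le_right (κH * (y / (1 - y))) (y / (1 - y) * κh)) hwH
      have e : (1 - γ) * t1 * (y / (1 - y) * κh) + γ * t0 * (y / (1 - y) * κh) + γ * t1 * (y / (1 - y) * κh)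
          = ((1 - γ) * t1 + γ * (t0 + t1)) * (y / (1 - y)) * κh := by ring
      linarith only [f1, f2, f3, k1, e]
    · have k1 := kink κH hκH0 hκHt
      have f1 := mul_le_mul_of_nonneg_left (min_le_right (κ1 * (y / (1 - y))) (y / (1 - y) * κH)) hw1
      have f2 := mul_le_mul_of_nonneg_left (min_le_right (κh * (y / (1 - y))) (y / (1 - y) * κH)) hwh
      have f3 := mul_le_mul_of_nonneg_left (min_le_right (κH * (y / (1 - y))) (y / (1 - y) * κH)) hwH
      have e : (1 - γ) * t1 * (y / (1 - y) * κH) + γ * t0 * (y / (1 - y) * κH) + γ * t1 * (y / (1 - y) * κH)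
          = ((1 - γ) * t1 + γ * (t0 + t1)) * (y / (1 - y)) * κH := by ring
      linarith only [f1, f2, f3, k1, e]
  · -- h + r not low: its coefficient is −p(h+r) ≤ 0
    rw [cN (h + r) hH1]
    have two := GluedWindow.twoCol_dual_three ((1 - γ) * t1) (γ * t0) 0 κ1 κh 0 (y / (1 - y)) (y / (1 - y)) 0
      (α (l + r)) (α h) 0 ((1 - γ) * t2) E pA P hw1 hwh le_rfl hκ10 hκh0 le_rfl hu0 hu0 le_rfl
      (mul_nonneg h1γ ht2p) hE0 hpA0 hP0 b1A bhA (by simp) b1P bhP (by simp) ?_ ?_ ?_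
    · have hpr := mul_nonneg hwH (hp (h + r))
      have eL : (1 - γ) * (t0 * α l + t1 * α (l + r) - t2 * pA) + γ * (t0 * α h + t1 * -p (h + r) - t2 * P)
          = (1 - γ) * (t0 * α l) + ((1 - γ) * t1 * α (l + r) + γ * t0 * α h + 0 * (0:ℝ)) - γ * t1 * p (h + r)
            - (1 - γ) * t2 * pA - γ * t2 * P := by ring
      have eR : (1 - γ) * t0 * (y / (1 - y)) * P + ((1 - γ) * t2 * pA + E * P) - (1 - γ) * t2 * pA - γ * t2 * P = 0 := by
        rw [hE]; ring
      linarith only [two, low1, eL, eR, hpr]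
    · have k1 := kink κ1 hκ10 hκ1t
      have f1 := mul_le_mul_of_nonneg_left (min_le_right (κ1 * (y / (1 - y))) (y / (1 - y) * κ1)) hw1
      have f2 := mul_le_mul_of_nonneg_left (min_le_right (κh * (y / (1 - y))) (y / (1 - y) * κ1)) hwh
      have f3 : 0 ≤ γ * t1 * (y / (1 - y)) * κ1 := mul_nonneg (mul_nonneg hwH hu0) hκ10
      have e : (1 - γ) * t1 * (y / (1 - y) * κ1) + γ * t0 * (y / (1 - y) * κ1) + γ * t1 * (y / (1 - y)) * κ1
          = ((1 - γ) * t1 + γ * (t0 + t1)) * (y / (1 - y)) * κ1 := by ring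
      have e0 : (0:ℝ) * min (0 * (y / (1 - y))) (0 * κ1) = 0 := by ring
      linarith only [f1, f2, f3, k1, e, e0]
    · have k1 := kink κh hκh0 hκht
      have f1 := mul_le_mul_of_nonneg_left (min_le_right (κ1 * (y / (1 - y))) (y / (1 - y) * κh)) hw1
      have f2 := mul_le_mul_of_nonneg_left (min_le_right (κh * (y / (1 - y))) (y / (1 - y) * κh)) hwh
      have f3 : 0 ≤ γ * t1 * (y / (1 - y)) * κh := mul_nonneg (mul_nonneg hwH hu0) hκh0
      have e : (1 - γ) * t1 * (y / (1 - y) * κh) + γ * t0 * (y / (1 - y) * κh) + γ * t1 * (y / (1 - y)) * κh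
          = ((1 - γ) * t1 + γ * (t0 + t1)) * (y / (1 - y)) * κh := by ring
      have e0 : (0:ℝ) * min (0 * (y / (1 - y))) (0 * κh) = 0 := by ring
      linarith only [f1, f2, f3, k1, e, e0]
    · have e1 : (1 - γ) * t1 * min (κ1 * 0) ((y / (1 - y)) * 0) = 0 := by simp
      have e2 : γ * t0 * min (κh * 0) ((y / (1 - y)) * 0) = 0 := by simp
      have e3 : (0:ℝ) * min (0 * 0) (0 * (0:ℝ)) = 0 := by simp
      have e4 : (1 - γ) * t2 * 0 + E * 0 = 0 := by ring
      linarith only [e1, e2, e3, e4]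

end LawDec
end Quant
end Summit.CriticalPhenomena.PercolationContinuityZ3.Theorems
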